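import Literature.MathematicalPhysics.QuantumFieldTheory.Balaban1983to89.B6Prop26Census2137KLevelV1
import Literature.MathematicalPhysics.QuantumFieldTheory.Balaban1983to89.B6HolderNormV1
import HarnessLib

/-!
# `Balaban1983to89.B6Prop26Census2139KLevelV1` — T. Bałaban, *Propagators and renormalization transformations for lattice gauge theories. II*,
Comm. Math. Phys. **96** (1984) 223–250 [Balaban1984PropagatorsII], p. 247 **PROPOSITION 2.6, THE MIXED HÖLDER ENTRY (2.139) — THE FOURTH CONJUNCT OF THE
VERBATIM CENSUS TYPING `…B6.Prop26Printed` ON THE GENUINE k-LEVEL V1 FAMILY (the census slot `c4` of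
`…B6Prop26PrintedStage2KLevelV1.prop26Printed_kLevel_of_slots5`), MODULO ITS TWO k-LEVEL INPUTS DISPLAYED**: the census slot `h2 J α ζ` (the Hölder
quotient `‖ζ∇_νG∇*_μJ‖_α` over the admissible ordered pairs, reading `B6Prop26Census2136KLevelV1.kG`) is bounded by
`C(α,ε)·(Lʲη)^{−α}·(‖ζ‖^ξ_α + |ζ|)·e^{−δ₃d(y,y′)}·(‖J‖^{ξ′}_{α+ε} + |J|)` with ONE threshold `M₁ ≤ M` and ONE rate chosen BEFORE the exponents, from
(he4) = the census slot `c3` ((2.138), the ENTRY bound `|(∇G∇*J)(x)|`) in its census shape VERBATIM and (hp4) = the PAIR majorant of `∇_νG∇*_μ` on the Hölder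
input class (`HasMajorantA` of `…B6RandomWalkInputNorm` for the class `NormSupp {y′} (‖·‖_{α+ε} + |·|)` of `…B6HolderNormV1`, kernel `A·t^α·e^{−δd_T}` — the
(2.141) walk in the pair currency, typed downstream).

HONEST FRAMING (programme rule): statement-level skeleton of published theorems with citation tags; proofs where landed; nothing here
is a claim about the Yang–Mills mass gap.

PRINT (verbatim, p. 247 [PDF 25]): «‖ζ∇G∇*J‖_α ≤ O(1)(L^jη)^{−α}(‖ζ‖^ξ_α + |ζ|)e^{−δ₃d(y,y′)}(‖J‖^{ξ′}_{α+ε} + |J|) (2.139) for 0 ≤ α < 1, ε > 0, α + ε < 1,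
ζ ∈ C₀^∞(Δ̃(y)), supp J ⊂ Δ̃(y′), with the constant O(1) depending on d, L, α, ε (O(1) → ∞ if α → 1 or ε → 0)»; (2.138): «|(∇G∇*J)(x)| ≤
O(1)e^{−δ₃d(y,y′)}(‖J‖^{ξ′}_ε + |J|)»; [4] (1.109) p. 35: «‖A‖_α = max_μ sup_{x,x′: |x−x′| ≤ 1} |x − x′|^{−α}|A_μ(x) − A_μ(x′)|».

## WHAT THIS FILE CERTIFIES (kernel-checked, sorry-free, standard axioms; THEOREMS ONLY)

* §0 bookkeeping: `adjLen_negrpow_le` (`ℓ_z^{−α} ≤ L·ℓ_y^{−α}` for adjacent blocks — the (2.139) prefactor moved to the census site, cf.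
  `…B6KLevelCensusBookkeepingV1.adjLen_rpow_le` for (2.137)), `abs_le_supIn` / `supIn_le_e4` (the census reading `kG.e4` dominates every entry
  `|(∇_νG∇*_μJ)(x)|`), `holder_mono_exponent` (`‖J‖^{ξ′}_ε ≤ ‖J‖^{ξ′}_{ε′}` for `ε ≤ ε′`: the quotient parameter `t ≤ 1` on admissible pairs),
  `pairDiffA_le_of_suppIn` (the pair reading of a `HasMajorantA` of `P_{x,x′}·T` on the census Hölder class);
* §1 **`holderQ_le_of_pair_entry_negrpow`** — THE HÖLDER QUOTIENT OF `ζ·F` FROM A PAIR BOUND AND AN ENTRY BOUND WITHOUT LENGTH: if `|F(f)| ≤ Cm·E(y(f))`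
  for every fine bond and `|F(u) − F(u′)| ≤ Cm·t^α·E(y(u))` on admissible ordered pairs (`E(z) = e^{−δ d_T(z, y′)}`), and `supp ζ` lies within torus
  distance 1 of the census site `y`, then `holderQ α ζ F ≤ 2·Cm·L·e^{δ}·ℓ_y^{−α}·(‖ζ‖^ξ_α + |ζ|)·e^{−δ d_T(y, y′)}` (`ℓ_y = len_T(y)·|c_f|⁻¹`) — r03's
  `…B6Prop26Census2137KLevelV1.holderQ_le_of_pair_entry` at the exponent `−α` (the `t`-cancellation `quot_cancel` leaves `ℓ^{−α}`; no `ℓ` from the bounds);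
* §2 **`prop26_census2139_kLevel_of_pair`** — THE (2.139) CONJUNCT OF `B6.Ineq2136_2140` UNIFORMLY ON THE GENUINE k-LEVEL FAMILY, in the shape of the
  census slot `c4` VERBATIM, from the displayed inputs (he4) (slot `c3` verbatim) and (hp4) (the pair majorant on the Hölder class); witnesses:
  `M₁ = max` of the thresholds (`N₁ + 1 ≤ R·L·M_h` covered by `N₁ + 1 ≤ L·M_h` since `R ≥ 1`), `δ₃ = min` of the two rates,
  `Cαε α ε = 2·max(C_ε(ε), A(α,ε))·L·e^{δ₃}` (junk outside the printed range of the exponents).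

## HONEST SCOPE

(1) (2.139) ONLY, MODULO the displayed inputs (he4) — the (2.138) slot, owed by its own assembly — and (hp4) — the pair walk
`P_{x,x′}∇G∇* = P_{x,x′}∇G₀∇* + (P_{x,x′}∇G)(R∇*)` at k levels, owed by `…B6Prop26HolderGrad2KLevelV1` (this seat's next file).  (2) Readings as in
`B6KLevelCensusIndexV1` / `B6Prop26Census2136KLevelV1`: admissibility = the symmetric pair condition, quotient `|x − x′|_phys^{−α}` (physical length
`|x − x′|_∞·|c_f|⁻¹`), `‖ζ‖^ξ_α` with the DIMENSIONLESS parameter `t`, `supp ζ ⊂ Δ̃(y)` = blocks within torus distance 1 of `y`; the census sub-case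
`supp J ⊂ Δ(y′)` of print's `Δ̃(y′)` (cell GAPS G-B6-2138-SUPP).  (3) Constants depend on `d, L, α, ε` AND the band.  THEOREMS ONLY; the displayed inputs
are hypothesis binders, not declarations.  NOT summit progress.  Unit `pub-ymgap-dag-n02-b` (Track-A seat, D-0062; slot c4 of node N03), 2026-08-25.
-/

noncomputable section

namespace Literature.MathematicalPhysics.QuantumFieldTheory.Balaban1983to89.B6Prop26Census2139KLevelV1

open LatticeFieldCalculus
open B6SectAOperatorsV1 (BondIdx)
open B6SectAVectorModelV1 (GE)
open B6Ineq2133TwoScaleV1 (onFun)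
open B6RandomWalk (HasMajorant BlockSupp)
open B6RandomWalkInputNorm (HasMajorantA NormSupp)
open B6MultiLevelBoxOperator (N0)
open B6MultiLevelTorusOperator (TDomains)
open B6GlobalChartV1 (PV domT blkV1)
open B6Geom246MultiLevelBox (bset)
open B6Geom246MultiLevelTorus (geomT)
open B8Ineq192MultiLevelTorus (lenT_eq lenT_pos symmT)
open B6Prop26KLevelAssemblyV1 (distT_nonneg)
open B6CubeWindowV1 (Placed GlobalBand)
open B6Cover236MultiLevelBlocks (cubes)
open B6GradLegKLevelV1 (DV)
open B6LapLegKLevelV1 (DVa)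
open B6HolderPairMemberV1 (pairOp pairOp_mul_apply abs_cutoff_pair_le)
open B6KLevelCensusIndexV1 (KIdx Adm tpar kGeoG lenG_eq_geomT adm_symm tpar_nonneg tpar_le_one)
open B6KLevelCensusBookkeepingV1 (quot_cancel adjLen_le_L exp_adj_le eq_of_supDist_eq_zero)
open B6Prop26Census2136KLevelV1 (Gop supIn holderQ kG)
open B6HolderNormV1 (holderV1 supNormV1 abs_apply_le_of_suppIn kGeoG_holder_eq kGeoG_supNorm_eq holderV1_nonneg supNormV1_nonneg)
open B3TorusRadialSums (supDist_comm)

variable {d ℓ : ℕ} {hd : 1 ≤ d + 1} {hL : Odd (ℓ + 1) ∧ 1 < ℓ + 1} {b₀ b₁ : ℝ}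

/-! ## §0  Bookkeeping -/

section Bookkeeping

variable {m K : ℕ} {Mh k R : ℕ} {P' : Fin (d + 1) → ℕ} (D : TDomains d ℓ Mh k P' R)

/-- **ADJACENT BLOCKS, THE (2.139) PREFACTOR** (negative power): `ℓ_z^{−α} ≤ L·ℓ_y^{−α}` for `d_T(z, y) ≤ 1`, `0 ≤ α ≤ 1`, `ℓ_• = len_T(•)·|c_f|⁻¹`,
under `R·L·M_h ≥ 2L` (`ℓ_y ≤ L·ℓ_z` by `adjLen_le_L` in the symmetric direction, then `ℓ_z^{−α} ≤ (ℓ_y/L)^{−α} = L^{α}ℓ_y^{−α} ≤ L·ℓ_y^{−α}`).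
[cite: Balaban1984PropagatorsII, (2.60) p.234, (2.139) p.247 (the prefactor `(Lʲη)^{−α}`), (2.2) p.224, bookkeeping] -/
theorem adjLen_negrpow_le (hMh : 1 ≤ Mh) (hP : ∀ μ, 1 ≤ P' μ) (hRM2L : 2 * (ℓ + 1) ≤ R * ((ℓ + 1) * Mh)) {cf : ℝ} (hcf : cf ≠ 0)
    {α : ℝ} (hα0 : 0 ≤ α) (hα1 : α ≤ 1) (y z : ↥(bset D.toDomains)) (hyz : (geomT D).dist z y ≤ 1) :
    ((geomT D).len z * |cf|⁻¹) ^ (-α) ≤ ((ℓ : ℝ) + 1) * ((geomT D).len y * |cf|⁻¹) ^ (-α) := by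
  have habs : 0 < |cf| := abs_pos.2 hcf
  have hLz : 0 < (geomT D).len z * |cf|⁻¹ := mul_pos (lenT_pos (D := D) z) (inv_pos.2 habs)
  have hLy : 0 < (geomT D).len y * |cf|⁻¹ := mul_pos (lenT_pos (D := D) y) (inv_pos.2 habs)
  have hL1 : (1 : ℝ) ≤ (ℓ : ℝ) + 1 := by linarith [(Nat.cast_nonneg ℓ : (0 : ℝ) ≤ ℓ)]
  have hL0 : (0 : ℝ) < (ℓ : ℝ) + 1 := by linarith
  -- `ℓ_y ≤ L·ℓ_z` (the pair `(z, y)` read in the other direction)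
  have hyz' : (geomT D).dist y z ≤ 1 := by rwa [symmT D y z]
  have hcmp : (geomT D).len y * |cf|⁻¹ ≤ ((ℓ : ℝ) + 1) * ((geomT D).len z * |cf|⁻¹) := adjLen_le_L D hMh hP hRM2L cf z y hyz'
  have hq : (geomT D).len y * |cf|⁻¹ / ((ℓ : ℝ) + 1) ≤ (geomT D).len z * |cf|⁻¹ := by
    rw [div_le_iff₀ hL0]; linarith [mul_comm ((ℓ : ℝ) + 1) ((geomT D).len z * |cf|⁻¹)]
  have hq0 : 0 < (geomT D).len y * |cf|⁻¹ / ((ℓ : ℝ) + 1) := div_pos hLy hL0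
  calc ((geomT D).len z * |cf|⁻¹) ^ (-α) ≤ ((geomT D).len y * |cf|⁻¹ / ((ℓ : ℝ) + 1)) ^ (-α) :=
        Real.rpow_le_rpow_of_nonpos hq0 hq (by linarith)
    _ = ((geomT D).len y * |cf|⁻¹) ^ (-α) * ((ℓ : ℝ) + 1) ^ α := by
        rw [Real.div_rpow hLy.le hL0.le, Real.rpow_neg hL0.le, div_inv_eq_mul]
    _ ≤ ((geomT D).len y * |cf|⁻¹) ^ (-α) * ((ℓ : ℝ) + 1) := by
        refine mul_le_mul_of_nonneg_left ?_ (Real.rpow_nonneg hLy.le _)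
        calc ((ℓ : ℝ) + 1) ^ α ≤ ((ℓ : ℝ) + 1) ^ (1 : ℝ) := Real.rpow_le_rpow_of_exponent_le hL1 hα1
          _ = (ℓ : ℝ) + 1 := Real.rpow_one _
    _ = ((ℓ : ℝ) + 1) * ((geomT D).len y * |cf|⁻¹) ^ (-α) := mul_comm _ _

end Bookkeeping

section Readings

/-- `|f(x)| ≤ sup_{x′ ∈ Δ(y(x))} |f(x′)|`. [cite: Balaban1984PropagatorsII, (2.136)/(2.138) p.247 («for x ∈ Δ(y)»), bookkeeping] -/
theorem abs_le_supIn (i : KIdx d ℓ hd hL b₀ b₁) (f : PBond (PV d ℓ i.m i.K hd hL) 0 → ℝ) (x : PBond (PV d ℓ i.m i.K hd hL) 0) :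
    |f x| ≤ supIn i (blkV1 i.hN i.D x) f :=
  le_ciSup (f := fun x' : {x' : PBond (PV d ℓ i.m i.K hd hL) 0 // blkV1 i.hN i.D x' = blkV1 i.hN i.D x} => |f x'.1|)
    (Set.finite_range _).bddAbove ⟨x, rfl⟩

/-- the census reading `e4 J y` dominates the block supremum of EVERY entry `∇_νG∇*_μJ`. [cite: Balaban1984PropagatorsII, (2.138) p.247, bookkeeping] -/
theorem supIn_le_e4 (i : KIdx d ℓ hd hL b₀ b₁) (J : PBond (PV d ℓ i.m i.K hd hL) 0 → ℝ) (y : (geomT i.D).Site) (ν μ : Fin (d + 1)) :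
    supIn i y ((DV ν i.cf ∘ₗ Gop i ∘ₗ DVa μ i.cf) J) ≤ (kG i).e4 J y := by
  have h1 : supIn i y ((DV ν i.cf ∘ₗ Gop i ∘ₗ DVa μ i.cf) J) ≤ ⨆ μ' : Fin (d + 1), supIn i y ((DV ν i.cf ∘ₗ Gop i ∘ₗ DVa μ' i.cf) J) :=
    le_ciSup (f := fun μ' : Fin (d + 1) => supIn i y ((DV ν i.cf ∘ₗ Gop i ∘ₗ DVa μ' i.cf) J)) (Set.finite_range _).bddAbove μ
  have h2 : (⨆ μ' : Fin (d + 1), supIn i y ((DV ν i.cf ∘ₗ Gop i ∘ₗ DVa μ' i.cf) J)) ≤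
      ⨆ ν' : Fin (d + 1), ⨆ μ' : Fin (d + 1), supIn i y ((DV ν' i.cf ∘ₗ Gop i ∘ₗ DVa μ' i.cf) J) :=
    le_ciSup (f := fun ν' : Fin (d + 1) => ⨆ μ' : Fin (d + 1), supIn i y ((DV ν' i.cf ∘ₗ Gop i ∘ₗ DVa μ' i.cf) J))
      (Set.finite_range _).bddAbove ν
  exact h1.trans h2

/-- **`‖J‖^{ξ′}_ε ≤ ‖J‖^{ξ′}_{ε′}` for `ε ≤ ε′`**: on an admissible ordered pair the quotient parameter satisfies `t ≤ 1`, so `t^{−ε} ≤ t^{−ε′}`; the degenerate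
pair (`t = 0`) has equal endpoints. [cite: Balaban1984PropagatorsII, (2.138)–(2.139) p.247; Balaban1984PropagatorsI, (1.109) p.35, bookkeeping] -/
theorem holder_mono_exponent (i : KIdx d ℓ hd hL b₀ b₁) {ε ε' : ℝ} (hεε : ε ≤ ε') (J : PBond (PV d ℓ i.m i.K hd hL) 0 → ℝ) :
    (kGeoG i).holder ε J ≤ (kGeoG i).holder ε' J := by
  classical
  have hbdd : BddAbove (Set.range fun q : PBond (PV d ℓ i.m i.K hd hL) 0 × PBond (PV d ℓ i.m i.K hd hL) 0 =>
      if Adm i q.1 q.2 then tpar i q.1 q.2 ^ (-ε') * |J q.1 - J q.2| else 0) := (Set.finite_range _).bddAbove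
  have h0 : 0 ≤ (kGeoG i).holder ε' J := Real.iSup_nonneg fun q => by
    by_cases hq : Adm i q.1 q.2
    · simp only [if_pos hq]; exact mul_nonneg (Real.rpow_nonneg (tpar_nonneg i _ _) _) (abs_nonneg _)
    · simp only [if_neg hq]; exact le_rfl
  refine Real.iSup_le (fun q => ?_) h0
  by_cases hq : Adm i q.1 q.2
  · simp only [if_pos hq]
    have hterm : tpar i q.1 q.2 ^ (-ε) * |J q.1 - J q.2| ≤ tpar i q.1 q.2 ^ (-ε') * |J q.1 - J q.2| := by
      rcases Nat.eq_zero_or_pos (supDist q.1.src q.2.src) with hs0 | hspos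
      · have heq : q.1 = q.2 := eq_of_supDist_eq_zero hq.1 hs0
        rw [heq, sub_self, abs_zero, mul_zero, mul_zero]
      · have ht : 0 < tpar i q.1 q.2 := by
          unfold tpar
          have : (0 : ℝ) < ((supDist q.1.src q.2.src : ℕ) : ℝ) := by exact_mod_cast hspos
          positivity
        exact mul_le_mul_of_nonneg_right (Real.rpow_le_rpow_of_exponent_ge ht (tpar_le_one i hq) (neg_le_neg hεε)) (abs_nonneg _)
    have hle := le_ciSup hbdd q
    simp only [if_pos hq] at hle
    exact hterm.trans hle
  · simp only [if_neg hq]; exact h0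

/-- **THE PAIR READING OF A `HasMajorantA` OF `P_{x,x′}·T` ON THE CENSUS HÖLDER CLASS**: for `supp J ⊂ Δ(y′)`,
`|(TJ)(x) − (TJ)(x′)| ≤ K(y(x), y′)·(‖J‖_ε + |J|)`. [cite: Balaban1984PropagatorsII, (2.139) p.247; Balaban1984PropagatorsI, (1.109) p.35, bookkeeping] -/
theorem pairDiffA_le_of_suppIn (i : KIdx d ℓ hd hL b₀ b₁) (ε : ℝ) (x x' : PBond (PV d ℓ i.m i.K hd hL) 0)
    {T : Module.End ℝ (PBond (PV d ℓ i.m i.K hd hL) 0 → ℝ)} {K' : (geomT i.D).Site → (geomT i.D).Site → ℝ}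
    (hT : HasMajorantA (g := geomT i.D) (blkV1 i.hN i.D)
      (NormSupp (g := geomT i.D) (blkV1 i.hN i.D) (fun y' => ({y'} : Set (geomT i.D).Site)) (fun _ J => holderV1 i.hN i.D ε J + supNormV1 J))
      (pairOp x x' * T) K')
    {J : PBond (PV d ℓ i.m i.K hd hL) 0 → ℝ} {y' : (geomT i.D).Site} (h : (kGeoG i).suppIn J y') :
    |T J x - T J x'| ≤ K' (blkV1 i.hN i.D x) y' * ((kGeoG i).holder ε J + (kGeoG i).supNorm J) := by
  have h1 := abs_apply_le_of_suppIn i ε hT h x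
  rwa [pairOp_mul_apply, if_pos rfl] at h1

end Readings

/-! ## §1  The Hölder quotient of `ζ·F` from a pair bound and an entry bound, no length -/

open Classical in
/-- **THE HÖLDER QUOTIENT OF `ζ·F` FROM A PAIR BOUND AND AN ENTRY BOUND, NO LENGTH** (the core of (2.139)): for an index `i`, a census site `y`, a cut-off
`ζ` supported within torus distance `1` of `y` with `|ζ| ≤ S₁` and `t^{−α}|ζ(u) − ζ(u′)| ≤ S₂` on admissible pairs, and a fine-bond function `F` with ENTRY bound
`|F(f)| ≤ Cm·e^{−δ d_T(y(f), w)}` and PAIR bound `|F(u) − F(u′)| ≤ Cm·t^α·e^{−δ d_T(y(u), w)}` on admissible pairs (`R·L·M_h ≥ 2L`, `0 ≤ α ≤ 1`):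
`holderQ i α ζ F ≤ 2·Cm·L·e^{δ}·(ℓ_y)^{−α}·(S₁ + S₂)·e^{−δ d_T(y, w)}`, `ℓ_y = len_T(y)·|c_f|⁻¹` — the physical quotient `(t·ℓ_u)^{−α}` against `t^α`
leaves `ℓ_u^{−α}`, moved to the census site by `adjLen_negrpow_le` and (2.54).
[cite: Balaban1984PropagatorsII, (2.139) p.247, (2.54) p.232, (2.60) p.234; Balaban1984PropagatorsI, (1.109) p.35] -/
theorem holderQ_le_of_pair_entry_negrpow (i : KIdx d ℓ hd hL b₀ b₁) {α : ℝ} (hα0 : 0 ≤ α) (hα1 : α ≤ 1)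
    (ζ F : PBond (PV d ℓ i.m i.K hd hL) 0 → ℝ) (y w : (geomT i.D).Site) {S1 S2 Cm δ : ℝ} (hS1 : 0 ≤ S1) (hS2 : 0 ≤ S2) (hCm : 0 ≤ Cm) (hδ : 0 ≤ δ)
    (hζ : ∀ f, ζ f ≠ 0 → (geomT i.D).dist (blkV1 i.hN i.D f) y ≤ 1)
    (hζ1 : ∀ f, |ζ f| ≤ S1) (hζ2 : ∀ x x', Adm i x x' → tpar i x x' ^ (-α) * |ζ x - ζ x'| ≤ S2)
    (hEnt : ∀ f, |F f| ≤ Cm * Real.exp (-(δ * (geomT i.D).dist (blkV1 i.hN i.D f) w)))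
    (hPr : ∀ u u', Adm i u u' → |F u - F u'| ≤ Cm * tpar i u u' ^ α * Real.exp (-(δ * (geomT i.D).dist (blkV1 i.hN i.D u) w))) :
    holderQ i α ζ F ≤ 2 * Cm * ((ℓ : ℝ) + 1) * Real.exp δ * ((geomT i.D).len y * |i.cf|⁻¹) ^ (-α) * (S1 + S2) *
      Real.exp (-(δ * (geomT i.D).dist y w)) := by
  have habs : 0 < |i.cf| := abs_pos.2 i.hcf
  have hMh1 : 1 ≤ i.Mh := le_trans (by norm_num) i.hM8
  have hP1 : ∀ μ, 1 ≤ i.P' μ := fun μ => le_trans (by norm_num) (i.hP5 μ)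
  have hRM2L : 2 * (ℓ + 1) ≤ i.R * ((ℓ + 1) * i.Mh) := by
    have h2 : 1 ≤ (ℓ + 1) * i.Mh := le_trans hMh1 (Nat.le_mul_of_pos_left _ (by omega))
    calc 2 * (ℓ + 1) ≤ 2 * (ℓ + 1) ^ 2 * 1 := by nlinarith
      _ ≤ i.R * ((ℓ + 1) * i.Mh) := Nat.mul_le_mul i.hR2 h2
  set ly : ℝ := (geomT i.D).len y * |i.cf|⁻¹ with hly
  have hly0 : 0 < ly := mul_pos (lenT_pos (D := i.D) y) (inv_pos.2 habs)
  set KL : ℝ := (ℓ : ℝ) + 1 with hKL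
  have hKL0 : 0 ≤ KL := by positivity
  have hRHS0 : 0 ≤ 2 * Cm * KL * Real.exp δ * ly ^ (-α) * (S1 + S2) * Real.exp (-(δ * (geomT i.D).dist y w)) := by positivity
  refine Real.iSup_le (fun q => ?_) hRHS0
  obtain ⟨x, x'⟩ := q
  simp only
  split_ifs with hadm
  swap
  · exact hRHS0
  obtain ⟨hdir, hs1, hs2⟩ := hadm
  have hadm' : Adm i x' x := adm_symm i ⟨hdir, hs1, hs2⟩
  -- the move from an adjacent block `z` to the census site `y`
  have hmove : ∀ z : (geomT i.D).Site, (geomT i.D).dist z y ≤ 1 →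
      ((geomT i.D).len z * |i.cf|⁻¹) ^ (-α) * Real.exp (-(δ * (geomT i.D).dist z w)) ≤
        KL * Real.exp δ * (ly ^ (-α) * Real.exp (-(δ * (geomT i.D).dist y w))) := by
    intro z hz
    have h1 := adjLen_negrpow_le i.D hMh1 hP1 hRM2L i.hcf hα0 hα1 y z hz
    have h2 := exp_adj_le i.D hMh1 hP1 hδ y z w hz
    have hEz0 : 0 ≤ Real.exp (-(δ * (geomT i.D).dist z w)) := (Real.exp_pos _).le
    calc ((geomT i.D).len z * |i.cf|⁻¹) ^ (-α) * Real.exp (-(δ * (geomT i.D).dist z w))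
        ≤ (KL * ly ^ (-α)) * (Real.exp δ * Real.exp (-(δ * (geomT i.D).dist y w))) :=
          mul_le_mul h1 h2 hEz0 (mul_nonneg hKL0 (Real.rpow_nonneg hly0.le _))
      _ = _ := by ring
  -- the quotient factor `(s·η) = t·ℓ_u` for either end `u` of the pair
  have hquot : ∀ u : PBond (PV d ℓ i.m i.K hd hL) 0,
      (((supDist x.src x'.src : ℕ) : ℝ) * |i.cf|⁻¹) =
        (((supDist x.src x'.src : ℕ) : ℝ) / (((ℓ + 1 : ℕ) : ℝ)) ^ (blkV1 i.hN i.D u).1.1) * ((geomT i.D).len (blkV1 i.hN i.D u) * |i.cf|⁻¹) := by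
    intro u
    rw [lenT_eq]
    have hLp : (0 : ℝ) < (((ℓ + 1 : ℕ) : ℝ)) ^ (blkV1 i.hN i.D u).1.1 := by positivity
    have hc' : (((ℓ + 1 : ℕ) : ℝ)) = (ℓ : ℝ) + 1 := by push_cast; ring
    rw [hc'] at hLp ⊢
    field_simp
  -- the common final step at an adjacent block `z`
  have hfinal : ∀ z : (geomT i.D).Site, (geomT i.D).dist z y ≤ 1 →
      ∀ T : ℝ, T ≤ 2 * Cm * (S1 + S2) * (((geomT i.D).len z * |i.cf|⁻¹) ^ (-α) * Real.exp (-(δ * (geomT i.D).dist z w))) →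
      T ≤ 2 * Cm * KL * Real.exp δ * ly ^ (-α) * (S1 + S2) * Real.exp (-(δ * (geomT i.D).dist y w)) := by
    intro z hz T hT
    have hm := hmove z hz
    calc T ≤ 2 * Cm * (S1 + S2) * (KL * Real.exp δ * (ly ^ (-α) * Real.exp (-(δ * (geomT i.D).dist y w)))) :=
          hT.trans (mul_le_mul_of_nonneg_left hm (by positivity))
      _ = _ := by ring
  -- the degenerate pair
  rcases Nat.eq_zero_or_pos (supDist x.src x'.src) with hs0 | hspos
  · have hxx : x = x' := eq_of_supDist_eq_zero hdir hs0
    subst hxx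
    simp only [sub_self, abs_zero, mul_zero]
    exact hRHS0
  have hsR : (0 : ℝ) < ((supDist x.src x'.src : ℕ) : ℝ) := by exact_mod_cast hspos
  have htx : 0 < tpar i x x' := by unfold tpar; positivity
  have htx' : 0 < tpar i x' x := by unfold tpar; rw [supDist_comm]; positivity
  by_cases hzx : ζ x = 0
  · by_cases hzx' : ζ x' = 0
    · rw [hzx, hzx']; simp only [zero_mul, sub_self, abs_zero, mul_zero]; exact hRHS0
    · -- `ζ(x) = 0 ≠ ζ(x′)`: the reversed pair `(x′, x)` at the block of `x′`
      have hz' : (geomT i.D).dist (blkV1 i.hN i.D x') y ≤ 1 := hζ x' hzx'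
      refine hfinal _ hz' _ ?_
      rw [hzx, zero_mul, zero_sub, abs_neg, abs_mul]
      have hζd : |ζ x'| ≤ tpar i x' x ^ α * S2 := by
        have h := hζ2 x' x hadm'
        rw [hzx, sub_zero] at h
        calc |ζ x'| = tpar i x' x ^ α * (tpar i x' x ^ (-α) * |ζ x'|) := by
              rw [← mul_assoc, Real.rpow_neg htx'.le, mul_inv_cancel₀ (Real.rpow_pos_of_pos htx' α).ne', one_mul]
          _ ≤ tpar i x' x ^ α * S2 := mul_le_mul_of_nonneg_left h (Real.rpow_nonneg htx'.le _)
      have hq := hquot x'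
      have hsc : supDist x'.src x.src = supDist x.src x'.src := supDist_comm _ _
      set lx' : ℝ := (geomT i.D).len (blkV1 i.hN i.D x') * |i.cf|⁻¹ with hlx'
      have hl0 : 0 < lx' := mul_pos (lenT_pos (D := i.D) _) (inv_pos.2 habs)
      set Ex' : ℝ := Real.exp (-(δ * (geomT i.D).dist (blkV1 i.hN i.D x') w)) with hEx'
      calc (((supDist x.src x'.src : ℕ) : ℝ) * |i.cf|⁻¹) ^ (-α) * (|ζ x'| * |F x'|)
          ≤ (((supDist x.src x'.src : ℕ) : ℝ) * |i.cf|⁻¹) ^ (-α) * ((tpar i x' x ^ α * S2) * (Cm * Ex')) :=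
            mul_le_mul_of_nonneg_left (mul_le_mul hζd (hEnt x') (abs_nonneg _) (by positivity)) (Real.rpow_nonneg (by positivity) _)
        _ = (tpar i x' x * lx') ^ (-α) * (tpar i x' x ^ α * (S2 * Cm * Ex')) := by
            rw [hq]; unfold tpar; rw [hsc]; ring
        _ = lx' ^ (-α) * (S2 * Cm * Ex') := quot_cancel htx' hl0.le
        _ = S2 * Cm * (lx' ^ (-α) * Ex') := by ring
        _ ≤ 2 * Cm * (S1 + S2) * (lx' ^ (-α) * Ex') := by
            have hA0 : 0 ≤ lx' ^ (-α) * Ex' := by positivity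
            have : S2 * Cm ≤ 2 * Cm * (S1 + S2) := by nlinarith
            exact mul_le_mul_of_nonneg_right this hA0
  · -- `ζ(x) ≠ 0`: the product rule, both terms at the block of `x`
    have hz : (geomT i.D).dist (blkV1 i.hN i.D x) y ≤ 1 := hζ x hzx
    refine hfinal _ hz _ ?_
    have hprod := abs_cutoff_pair_le ζ F x x'
    have hζd : |ζ x - ζ x'| ≤ tpar i x x' ^ α * S2 := by
      have h := hζ2 x x' ⟨hdir, hs1, hs2⟩
      calc |ζ x - ζ x'| = tpar i x x' ^ α * (tpar i x x' ^ (-α) * |ζ x - ζ x'|) := by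
            rw [← mul_assoc, Real.rpow_neg htx.le, mul_inv_cancel₀ (Real.rpow_pos_of_pos htx α).ne', one_mul]
        _ ≤ tpar i x x' ^ α * S2 := mul_le_mul_of_nonneg_left h (Real.rpow_nonneg htx.le _)
    have hq := hquot x
    set lx : ℝ := (geomT i.D).len (blkV1 i.hN i.D x) * |i.cf|⁻¹ with hlx
    have hl0 : 0 < lx := mul_pos (lenT_pos (D := i.D) _) (inv_pos.2 habs)
    set Ex : ℝ := Real.exp (-(δ * (geomT i.D).dist (blkV1 i.hN i.D x) w)) with hEx
    have hT1 : |ζ x'| * |F x - F x'| ≤ S1 * (Cm * tpar i x x' ^ α * Ex) :=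
      mul_le_mul (hζ1 x') (hPr x x' ⟨hdir, hs1, hs2⟩) (abs_nonneg _) hS1
    have hT2 : |ζ x - ζ x'| * |F x| ≤ (tpar i x x' ^ α * S2) * (Cm * Ex) :=
      mul_le_mul hζd (hEnt x) (abs_nonneg _) (by positivity)
    calc (((supDist x.src x'.src : ℕ) : ℝ) * |i.cf|⁻¹) ^ (-α) * |ζ x * F x - ζ x' * F x'|
        ≤ (((supDist x.src x'.src : ℕ) : ℝ) * |i.cf|⁻¹) ^ (-α) * (S1 * (Cm * tpar i x x' ^ α * Ex) + (tpar i x x' ^ α * S2) * (Cm * Ex)) :=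
          mul_le_mul_of_nonneg_left (hprod.trans (add_le_add hT1 hT2)) (Real.rpow_nonneg (by positivity) _)
      _ = (tpar i x x' * lx) ^ (-α) * (tpar i x x' ^ α * ((S1 + S2) * Cm * Ex)) := by
          rw [hq]; unfold tpar; ring
      _ = lx ^ (-α) * ((S1 + S2) * Cm * Ex) := quot_cancel htx hl0.le
      _ = (S1 + S2) * Cm * (lx ^ (-α) * Ex) := by ring
      _ ≤ 2 * Cm * (S1 + S2) * (lx ^ (-α) * Ex) := by
          have hA0 : 0 ≤ lx ^ (-α) * Ex := by positivity
          have : (S1 + S2) * Cm ≤ 2 * Cm * (S1 + S2) := by nlinarith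
          exact mul_le_mul_of_nonneg_right this hA0

/-! ## §2  The (2.139) conjunct of the census, uniformly on the family, from the displayed k-level inputs -/

open Classical in
/-- **[B6] PROPOSITION 2.6 (2.139), THE FOURTH CONJUNCT OF `B6.Prop26Printed`'s `Ineq2136_2140`, ON THE GENUINE k-LEVEL V1 FAMILY, MODULO ITS TWO
k-LEVEL INPUTS** — `‖ζ∇G∇*J‖_α ≤ C(α,ε)(Lʲη)^{−α}(‖ζ‖^ξ_α + |ζ|)e^{−δ₃d(y,y′)}(‖J‖^{ξ′}_{α+ε} + |J|)` for `supp ζ ⊂ Δ̃(y)`, `supp J ⊂ Δ(y′)`, `0 ≤ α`, `0 < ε`,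
`α + ε < 1`, with ONE threshold `M₁ ≤ M` and ONE rate for the whole family and all exponents (the census slot `c4` of
`…B6Prop26PrintedStage2KLevelV1.prop26Printed_kLevel_of_slots5`, CHARACTER FOR CHARACTER), from: `he4` = the census slot `c3` VERBATIM (the ENTRY bound
(2.138) `|(∇G∇*J)(x)| ≤ C(ε)e^{−δ₃d}(‖J‖^{ξ′}_ε + |J|)`, read through `kG.e4`) and `hp4` = the PAIR majorant of `∇_νG∇*_μ` on the Hölder input class
(`HasMajorantA (NormSupp {y′} (‖·‖_{α+ε} + |·|)) (P_{x,x′}·∇_νG∇*_μ) (A·t^α·e^{−δ d_T})` on admissible ordered pairs, threshold before the exponents).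
[cite: Balaban1984PropagatorsII, Prop. 2.6 (2.139) p.247, (2.138) p.247, (2.141) p.247, (2.54) p.232, (2.60) p.234; Balaban1984PropagatorsI, (1.109) p.35] -/
theorem prop26_census2139_kLevel_of_pair
    (he4 : ∃ M₁ δ₃ : ℝ, ∃ Cε : ℝ → ℝ, 0 < M₁ ∧ 0 < δ₃ ∧ ∀ i : KIdx d ℓ hd hL b₀ b₁, M₁ ≤ (kGeoG i).M →
      ∀ (ε : ℝ) (J : (kGeoG i).Loc) (y y' : (kGeoG i).Site), 0 < ε → ε < 1 → (kGeoG i).suppIn J y' →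
        (kG i).e4 J y ≤ Cε ε * Real.exp (-(δ₃ * (kGeoG i).dist y y')) * ((kGeoG i).holder ε J + (kGeoG i).supNorm J))
    (hp4 : ∃ (δ M₂ : ℝ) (N₁ : ℕ), 0 < δ ∧ 0 < M₂ ∧ ∀ (α ε : ℝ), 0 ≤ α → 0 < ε → α + ε < 1 → ∃ A : ℝ, 0 ≤ A ∧
      ∀ (m K : ℕ) {Mh k R : ℕ} {P' : Fin (d + 1) → ℕ}
        (hN : ∀ μ, N0 ℓ Mh k P' μ = (PV d ℓ m K hd hL).sitesPerDir 0) (D : TDomains d ℓ Mh k P' R) (hk : k ≤ m + K) (_ : 2 ≤ k)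
        {a : ℕ} (_ : Mh = (ℓ + 1) ^ a) (_ : 8 ≤ Mh) (_ : 2 * (ℓ + 1) ^ 2 ≤ R) (_ : ∀ μ, 5 ≤ P' μ) (_ : 4 ≤ ℓ)
        (_ : ∀ c : ↥(cubes D.toDomains), Placed ℓ k P' c.1) (_ : M₂ ≤ ((ℓ : ℝ) + 1) * Mh) (_ : N₁ + 1 ≤ R * ((ℓ + 1) * Mh))
        {cf : ℝ} (hcf : cf ≠ 0) {w : BondIdx (domT hN D hk) → ℝ} (hw : ∀ i, 0 < w i) (_ : GlobalBand b₀ b₁ cf w)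
        (ν μ : Fin (d + 1)) (x x' : PBond (PV d ℓ m K hd hL) 0), x.dir = x'.dir →
        supDist x.src x'.src ≤ (ℓ + 1) ^ (blkV1 hN D x).1.1 → supDist x.src x'.src ≤ (ℓ + 1) ^ (blkV1 hN D x').1.1 →
        HasMajorantA (g := geomT D) (blkV1 hN D)
          (NormSupp (g := geomT D) (blkV1 hN D) (fun y' => ({y'} : Set (geomT D).Site)) (fun _ J => holderV1 hN D (α + ε) J + supNormV1 J))
          (pairOp x x' * (DV (P := PV d ℓ m K hd hL) ν cf * onFun (GE (domT hN D hk) hcf hw) * DVa μ cf))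
          (fun y y' => A * ((((supDist x.src x'.src : ℕ) : ℝ) / (((ℓ + 1 : ℕ) : ℝ)) ^ (blkV1 hN D x).1.1) ^ α) *
            Real.exp (-(δ * (geomT D).dist y y')))) :
    ∃ M₁ δ₃ : ℝ, ∃ Cαε : ℝ → ℝ → ℝ, 0 < M₁ ∧ 0 < δ₃ ∧ ∀ i : KIdx d ℓ hd hL b₀ b₁, M₁ ≤ (kGeoG i).M →
      ∀ (α ε : ℝ) (J : (kGeoG i).Loc) (ζ : (kGeoG i).Cut) (y y' : (kGeoG i).Site), 0 ≤ α → 0 < ε → α + ε < 1 →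
        (kGeoG i).cutIn ζ y → (kGeoG i).suppIn J y' →
        (kG i).h2 J α ζ ≤ Cαε α ε * ((kGeoG i).len y) ^ (-α) * (kGeoG i).cutH α ζ * Real.exp (-(δ₃ * (kGeoG i).dist y y')) *
          ((kGeoG i).holder (α + ε) J + (kGeoG i).supNorm J) := by
  -- the two inputs
  obtain ⟨Me, δe, Ce, hMe, hδe, hE⟩ := he4
  obtain ⟨δp, Mp, Np, hδp, hMp, hP⟩ := hp4
  set δ₃ : ℝ := min δe δp with hδ₃_def
  have hδ₃ : 0 < δ₃ := lt_min hδe hδp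
  have hδ₃e : δ₃ ≤ δe := min_le_left _ _
  have hδ₃p : δ₃ ≤ δp := min_le_right _ _
  -- the pair constant as a function of `(α, ε)` (junk outside the printed range)
  set Ap : ℝ → ℝ → ℝ := fun α ε => if h : 0 ≤ α ∧ 0 < ε ∧ α + ε < 1 then Classical.choose (hP α ε h.1 h.2.1 h.2.2) else 0 with hApdef
  have hAp_0 : ∀ α ε, 0 ≤ Ap α ε := by
    intro α ε; simp only [hApdef]; split_ifs with h
    · exact (Classical.choose_spec (hP α ε h.1 h.2.1 h.2.2)).1
    · exact le_rfl
  set KL : ℝ := (ℓ : ℝ) + 1 with hKL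
  set Cm : ℝ → ℝ → ℝ := fun α ε => max (Ce ε) (Ap α ε) with hCmdef
  have hCm0 : ∀ α ε, 0 ≤ Cm α ε := fun α ε => (hAp_0 α ε).trans (le_max_right _ _)
  refine ⟨max (max Me Mp) ((Np : ℝ) + 1), δ₃, fun α ε => 2 * Cm α ε * KL * Real.exp δ₃, ?_, hδ₃,
    fun i hM α ε J ζ y y' hα0 hε0 hαε hζ hJ => ?_⟩
  · exact lt_max_of_lt_left (lt_max_of_lt_left hMe)
  have hα1 : α < 1 := by linarith
  have hε1' : ε < 1 := by linarith
  -- thresholds of the index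
  have hM' : max (max Me Mp) ((Np : ℝ) + 1) ≤ (((ℓ + 1 : ℕ) : ℝ)) * (i.Mh : ℝ) := hM
  have hcast : (((ℓ + 1 : ℕ) : ℝ)) = (ℓ : ℝ) + 1 := by push_cast; ring
  have hMei : Me ≤ (kGeoG i).M := ((le_max_left _ _).trans (le_max_left _ _)).trans hM
  have hMpi : Mp ≤ ((ℓ : ℝ) + 1) * i.Mh := by rw [← hcast]; exact ((le_max_right _ _).trans (le_max_left _ _)).trans hM'
  have hR1 : 1 ≤ i.R := le_trans (Nat.one_le_two_pow) (le_trans (Nat.pow_le_pow_left (by omega : 2 ≤ ℓ + 1) 2 |>.trans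
    (Nat.le_mul_of_pos_left _ (by norm_num))) i.hR2)
  have hNpi : Np + 1 ≤ i.R * ((ℓ + 1) * i.Mh) := by
    have h1 : ((Np : ℝ) + 1) ≤ (((ℓ + 1 : ℕ) : ℝ)) * (i.Mh : ℝ) := (le_max_right _ _).trans hM'
    have h2 : Np + 1 ≤ (ℓ + 1) * i.Mh := by exact_mod_cast h1
    exact h2.trans (Nat.le_mul_of_pos_left _ hR1)
  -- the inputs at the index
  have hEnt := hE i hMei ε J
  have hspec := Classical.choose_spec (hP α ε hα0 hε0 hαε)
  have hApeq : Ap α ε = Classical.choose (hP α ε hα0 hε0 hαε) := by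
    simp only [hApdef, dif_pos (And.intro hα0 (And.intro hε0 hαε))]
  rw [← hApeq] at hspec
  obtain ⟨-, hQ⟩ := hspec
  have hPair := hQ i.m i.K i.hN i.D i.hk i.hk2 i.hMha i.hM8 i.hR2 i.hP5 i.hℓ i.hpl hMpi hNpi i.hcf i.hw i.hwb
  clear hQ hE
  -- `J`: «supp J ⊂ Δ(y′)», size `N = ‖J‖_{α+ε} + |J|`, and `‖J‖_ε + |J| ≤ N`
  set N : ℝ := (kGeoG i).holder (α + ε) J + (kGeoG i).supNorm J with hN_def
  have hNe : (kGeoG i).holder ε J + (kGeoG i).supNorm J ≤ N :=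
    add_le_add (holder_mono_exponent i (by linarith : ε ≤ α + ε) J) le_rfl
  have hN0' : 0 ≤ (kGeoG i).holder ε J + (kGeoG i).supNorm J := by
    rw [kGeoG_holder_eq, kGeoG_supNorm_eq]; exact add_nonneg (holderV1_nonneg _ _ ε J) (supNormV1_nonneg J)
  have hN0 : 0 ≤ N := hN0'.trans hNe
  -- the cut-off readings
  set S1 : ℝ := ⨆ f : PBond (PV d ℓ i.m i.K hd hL) 0, |ζ f| with hS1
  set S2 : ℝ := ⨆ q : PBond (PV d ℓ i.m i.K hd hL) 0 × PBond (PV d ℓ i.m i.K hd hL) 0,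
    if Adm i q.1 q.2 then tpar i q.1 q.2 ^ (-α) * |ζ q.1 - ζ q.2| else 0 with hS2
  have hS1_0 : 0 ≤ S1 := Real.iSup_nonneg fun f => abs_nonneg _
  have hS2_0 : 0 ≤ S2 := Real.iSup_nonneg fun q => by
    split_ifs
    · exact mul_nonneg (Real.rpow_nonneg (tpar_nonneg i _ _) _) (abs_nonneg _)
    · exact le_rfl
  have hcutH : (kGeoG i).cutH α ζ = S1 + S2 := rfl
  have hζ1 : ∀ f, |ζ f| ≤ S1 := fun f => le_ciSup (f := fun f => |ζ f|) (Set.finite_range _).bddAbove f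
  have hζ2 : ∀ x x', Adm i x x' → tpar i x x' ^ (-α) * |ζ x - ζ x'| ≤ S2 := by
    intro x x' hadm
    have := le_ciSup (f := fun q : PBond (PV d ℓ i.m i.K hd hL) 0 × PBond (PV d ℓ i.m i.K hd hL) 0 =>
      if Adm i q.1 q.2 then tpar i q.1 q.2 ^ (-α) * |ζ q.1 - ζ q.2| else 0) (Set.finite_range _).bddAbove (x, x')
    simp only [if_pos hadm] at this
    exact this
  have hζ' : ∀ f, ζ f ≠ 0 → (geomT i.D).dist (blkV1 i.hN i.D f) y ≤ 1 := hζ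
  -- common
  have habs : 0 < |i.cf| := abs_pos.2 i.hcf
  set ly : ℝ := (geomT i.D).len y * |i.cf|⁻¹ with hly
  have hlyG : (kGeoG i).len y = ly := lenG_eq_geomT i y
  have hly0 : 0 < ly := mul_pos (lenT_pos (D := i.D) y) (inv_pos.2 habs)
  have hrate : ∀ {δ : ℝ} (_ : δ₃ ≤ δ) (z : (geomT i.D).Site), Real.exp (-(δ * (geomT i.D).dist z y')) ≤ Real.exp (-(δ₃ * (geomT i.D).dist z y')) :=
    fun hδ z => Real.exp_le_exp.2 (neg_le_neg (mul_le_mul_of_nonneg_right hδ (distT_nonneg z y')))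
  -- THE TARGET: `⨆ ν μ, holderQ … (∇_νG∇*_μJ) ≤ 2·Cm·KL·e^{δ₃}·ly^{−α}·(S1+S2)·e^{−δ₃ d}·N`
  rw [hcutH, hlyG]
  show (⨆ ν : Fin (d + 1), ⨆ μ : Fin (d + 1), holderQ i α ζ ((DV ν i.cf ∘ₗ Gop i ∘ₗ DVa μ i.cf) J)) ≤
    2 * Cm α ε * KL * Real.exp δ₃ * ly ^ (-α) * (S1 + S2) * Real.exp (-(δ₃ * (geomT i.D).dist y y')) * N
  have hRHS0 : 0 ≤ 2 * Cm α ε * KL * Real.exp δ₃ * ly ^ (-α) * (S1 + S2) * Real.exp (-(δ₃ * (geomT i.D).dist y y')) * N := by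
    have := hCm0 α ε; have := Real.rpow_nonneg hly0.le (-α); positivity
  refine Real.iSup_le (fun ν => Real.iSup_le (fun μ => ?_) hRHS0) hRHS0
  set F : PBond (PV d ℓ i.m i.K hd hL) 0 → ℝ := (DV ν i.cf ∘ₗ Gop i ∘ₗ DVa μ i.cf) J with hF
  -- the ENTRY bound from `he4`: `|F(f)| ≤ supIn ≤ e4 J (y(f)) ≤ Ce(ε)·e^{−δe d}·(‖J‖_ε + |J|) ≤ Cm·e^{−δ₃ d}·N`
  have hEntF : ∀ f, |F f| ≤ (Cm α ε * N) * Real.exp (-(δ₃ * (geomT i.D).dist (blkV1 i.hN i.D f) y')) := by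
    intro f
    have h1 : |F f| ≤ (kG i).e4 J (blkV1 i.hN i.D f) := (abs_le_supIn i F f).trans (supIn_le_e4 i J _ ν μ)
    have h2 := hEnt (blkV1 i.hN i.D f) y' hε0 hε1' hJ
    have hE0 : 0 ≤ Real.exp (-(δe * (geomT i.D).dist (blkV1 i.hN i.D f) y')) := (Real.exp_pos _).le
    -- `Ce ε ≤ Cm`, and the sign of `Ce ε` is immaterial once bounded by the nonnegative product
    have h3 : Ce ε * Real.exp (-(δe * (geomT i.D).dist (blkV1 i.hN i.D f) y')) * ((kGeoG i).holder ε J + (kGeoG i).supNorm J) ≤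
        Cm α ε * Real.exp (-(δ₃ * (geomT i.D).dist (blkV1 i.hN i.D f) y')) * N := by
      have hCe : Ce ε ≤ Cm α ε := le_max_left _ _
      calc Ce ε * Real.exp (-(δe * (geomT i.D).dist (blkV1 i.hN i.D f) y')) * ((kGeoG i).holder ε J + (kGeoG i).supNorm J)
          ≤ Cm α ε * Real.exp (-(δe * (geomT i.D).dist (blkV1 i.hN i.D f) y')) * ((kGeoG i).holder ε J + (kGeoG i).supNorm J) :=
            mul_le_mul_of_nonneg_right (mul_le_mul_of_nonneg_right hCe hE0) hN0'
        _ ≤ Cm α ε * Real.exp (-(δ₃ * (geomT i.D).dist (blkV1 i.hN i.D f) y')) * N :=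
            mul_le_mul (mul_le_mul_of_nonneg_left (hrate hδ₃e _) (hCm0 α ε)) hNe hN0' (by have := hCm0 α ε; positivity)
    calc |F f| ≤ _ := h1.trans h2
      _ ≤ _ := h3
      _ = (Cm α ε * N) * Real.exp (-(δ₃ * (geomT i.D).dist (blkV1 i.hN i.D f) y')) := by ring
  -- the PAIR bound from `hp4`
  have hPrF : ∀ u u', Adm i u u' → |F u - F u'| ≤ (Cm α ε * N) * tpar i u u' ^ α * Real.exp (-(δ₃ * (geomT i.D).dist (blkV1 i.hN i.D u) y')) := by
    intro u u' hadm
    obtain ⟨hd', h1', h2'⟩ := hadm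
    have hmaj := hPair ν μ u u' hd' h1' h2'
    have h := pairDiffA_le_of_suppIn i (α + ε) u u' hmaj hJ
    have ht0 : 0 ≤ tpar i u u' ^ α := Real.rpow_nonneg (tpar_nonneg i _ _) _
    have hAp : Ap α ε ≤ Cm α ε := le_max_right _ _
    calc |F u - F u'| ≤ Ap α ε * tpar i u u' ^ α * Real.exp (-(δp * (geomT i.D).dist (blkV1 i.hN i.D u) y')) * N := h
      _ ≤ Cm α ε * tpar i u u' ^ α * Real.exp (-(δ₃ * (geomT i.D).dist (blkV1 i.hN i.D u) y')) * N := by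
          refine mul_le_mul_of_nonneg_right ?_ hN0
          exact mul_le_mul (mul_le_mul_of_nonneg_right hAp ht0) (hrate hδ₃p _) (Real.exp_pos _).le (mul_nonneg (hCm0 α ε) ht0)
      _ = (Cm α ε * N) * tpar i u u' ^ α * Real.exp (-(δ₃ * (geomT i.D).dist (blkV1 i.hN i.D u) y')) := by ring
  -- §1 with the constant `Cm·N`
  have hCmN : 0 ≤ Cm α ε * N := mul_nonneg (hCm0 α ε) hN0
  have h := holderQ_le_of_pair_entry_negrpow i hα0 hα1.le ζ F y y' hS1_0 hS2_0 hCmN hδ₃.le hζ' hζ1 hζ2 hEntF hPrF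
  calc holderQ i α ζ F ≤ 2 * (Cm α ε * N) * ((ℓ : ℝ) + 1) * Real.exp δ₃ * ((geomT i.D).len y * |i.cf|⁻¹) ^ (-α) * (S1 + S2) *
        Real.exp (-(δ₃ * (geomT i.D).dist y y')) := h
    _ = _ := by rw [hKL, hly]; ring

end Literature.MathematicalPhysics.QuantumFieldTheory.Balaban1983to89.B6Prop26Census2139KLevelV1

end
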